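import Mathlib
import HarnessLib
import Summits.Parity.GeneralizedHardyLittlewood.Theorems.DilatedChowla.Negative.DilatedChowlaPretender
import Summits.Parity.GeneralizedHardyLittlewood.Theorems.DilatedChowla.Negative.DilatedChowlaPretenderPNT

/-!
# `DilatedChowla` (stmt-Parity-13319): the crux extended to pretenders is false

Assembly (cdisprove seat) of `DilatedChowlaPretender` (the steering construction
`pretender_failure`, `card_switchSet_eq_primeCounting_sub`) and `DilatedChowlaPretenderPNT`
(`primeCounting_window_ge`, `eventually_trivial_gt_log`): the crux's inequality at
`(c,n,n') = (1,1,2)`, asked of every completely multiplicative `±1`-valued `f` with `f = λ` at all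
primes `≤ 2M+1`, is false (`not_dilatedChowlaForPretenders`).  A proof of the crux must use the
values of `λ` at primes above the length of the sum.

What those values ARE, for `f = λ`: the exact splitting `S_one_one_two_split` —
`S 1 1 2 M = Σ_{m∈(M,2M], 2m+1 composite} λ(m+1)λ(2m+1) + Σ_{2M+1 < p ≤ 4M+1, p prime} λ(p+1)`
(for `p = 2m+1` prime the term is `λ(m+1)λ(p) = −λ(m+1) = λ(2m+2) = λ(p+1)`).  So already the
simplest instance of the crux carries, next to a composite part, a LIOUVILLE-AT-SHIFTED-PRIMES sum
over a dyadic window — the object of the open `Σ_{p≤x} λ(p+1) = o(π(x))` problem (tree: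
`Literature…MoebiusShiftedPrimesConjecture`, Lichtman–Teräväinen on average over shifts) — and the
pretender theorem says exactly this part cannot be discarded by any argument blind to `λ` on
`(2M+1, 4M+1]`.  (No implication either way is claimed: the composite part is not controlled
separately.)  Finally the SCALING SYMMETRY `S_scale`: `S (dc) (dn) (dn') M = S c n n' M` for
`d ≥ 1`, so everything said at `(1,1,2)` holds verbatim at `(d, d, 2d)`, `d ≤ M` — the obstruction
is not an artefact of the shift `c = 1`, and common factors of `(c, n, n')` neither help nor hurt.
[folklore]
-/

noncomputable section

namespace Summit.Parity.GeneralizedHardyLittlewood.Theorems.DilatedChowla.Negative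

open Summit.Parity.GeneralizedHardyLittlewood.Theorems.DilatedTableChowla.Negative
  (L L_natCast L_natCast_mul L_mul_self_of_pos L_nonpos_arg)
open Finset Filter

/-- The crux's inequality at `(c,n,n') = (1,1,2)`, asked of EVERY completely multiplicative
`±1`-valued `f` that agrees with `λ` at all primes `p ≤ 2M + 1` (uniform constants).  For
`f = λ` the sum is the crux's `S 1 1 2 M` (`sum_twist_empty_eq_S`). -/
def DilatedChowlaForPretenders : Prop :=
  ∃ κ : ℝ, 0 < κ ∧ ∃ C : ℝ, ∀ M : ℕ, ∀ f : ℕ → ℝ, (∀ a b : ℕ, f (a * b) = f a * f b) →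
    (∀ k : ℕ, 1 ≤ k → f k = 1 ∨ f k = -1) → (∀ p : ℕ, p.Prime → p ≤ 2 * M + 1 → f p = -1) →
      |∑ m ∈ Ioc M (2 * M), f (m + 1) * f (2 * m + 1)| ≤ C * (M : ℝ) ^ (1 - κ)

/-- **The pretender obstruction.** `DilatedChowlaForPretenders` is false: by `pretender_failure`
and the prime number theorem some admissible `f` has pencil sum
`≥ π(4M+1) − π(2M+1) ≥ M/log(2M+1)` in modulus at every large `M`, which beats `C · M^{1−κ}`. -/
theorem not_dilatedChowlaForPretenders : ¬ DilatedChowlaForPretenders := by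
  rintro ⟨κ, hκ, C, hC⟩
  obtain ⟨M₀, hM₀⟩ := primeCounting_window_ge
  obtain ⟨M, hMM₀, hlt⟩ :=
    ((eventually_ge_atTop (max M₀ 1)).and (eventually_trivial_gt_log hκ C)).exists
  have hM0 : M₀ ≤ M := le_trans (le_max_left _ _) hMM₀
  have hM1 : (1 : ℝ) ≤ M := by exact_mod_cast le_trans (le_max_right _ _) hMM₀
  obtain ⟨f, hmul, hsign, hprime, hbig⟩ := pretender_failure M
  have hbound := hC M f hmul hsign hprime
  have hcount := hM₀ M hM0
  have hmono : Nat.primeCounting (2 * M + 1) ≤ Nat.primeCounting (4 * M + 1) :=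
    Nat.monotone_primeCounting (by omega)
  have hcard : ((switchSet M).card : ℝ) =
      (Nat.primeCounting (4 * M + 1) : ℝ) - Nat.primeCounting (2 * M + 1) := by
    rw [card_switchSet_eq_primeCounting_sub, Nat.cast_sub hmono]
  have hlogpos : 0 < Real.log (2 * M + 1) := Real.log_pos (by linarith)
  -- `M / log(2M+1) ≤ π(4M+1) − π(2M+1) = #switch ≤ |Σ| ≤ C M^{1-κ} < M / log(2M+1)`
  have h1 : (M : ℝ) / Real.log (2 * M + 1) ≤ C * (M : ℝ) ^ (1 - κ) := by
    rw [← hcard] at hcount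
    exact le_trans hcount (le_trans hbig hbound)
  rw [div_le_iff₀ hlogpos] at h1
  linarith

/-! ## The `λ`-instance: composite part plus Liouville at shifted primes -/

/-- `λ(p) = −1` at a prime, in the crux's convention. -/
theorem L_prime {p : ℕ} (hp : p.Prime) : L (p : ℤ) = -1 := by
  rw [L_natCast, ArithmeticFunction.liouville_apply hp.ne_zero,
    ArithmeticFunction.cardFactors_apply_prime hp]
  norm_num

/-- **Exact splitting of the simplest instance of the crux.**
`S 1 1 2 M = Σ_{m∈(M,2M], 2m+1 not prime} λ(m+1)λ(2m+1) + Σ_{p ∈ (2M+1,4M+1] prime} λ(p+1)`: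
the prime values `p = 2m+1` of the second form contribute `λ(m+1)λ(p) = −λ(m+1) = λ(p+1)`, a
Liouville-at-shifted-primes sum over the dyadic window `(2M+1, 4M+1]`. -/
theorem S_one_one_two_split (M : ℕ) :
    S 1 1 2 M =
      (∑ m ∈ (Ioc M (2 * M)).filter (fun m => ¬ (2 * m + 1).Prime),
          L ((m + 1 : ℕ) : ℤ) * L ((2 * m + 1 : ℕ) : ℤ)) +
        ∑ p ∈ (Ioc (2 * M + 1) (4 * M + 1)).filter Nat.Prime, L ((p + 1 : ℕ) : ℤ) := by
  -- rewrite the pencil sum with natural-number arguments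
  have hS : S 1 1 2 M = ∑ m ∈ Ioc M (2 * M), L ((m + 1 : ℕ) : ℤ) * L ((2 * m + 1 : ℕ) : ℤ) := by
    unfold S
    refine sum_congr rfl fun m _ => ?_
    congr 1
    · congr 1; push_cast; ring
    · congr 1; push_cast; ring
  rw [hS, ← sum_filter_add_sum_filter_not (Ioc M (2 * M)) (fun m => (2 * m + 1).Prime), add_comm]
  congr 1
  -- the prime-value terms: reindex by `p = 2m+1` and use `λ(m+1)λ(p) = λ(2(m+1)) = λ(p+1)`
  rw [← image_switchSet, sum_image (fun a _ b _ (h : 2 * a + 1 = 2 * b + 1) => by omega)]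
  refine sum_congr rfl fun m hm => ?_
  have hp : (2 * m + 1).Prime := (mem_switchSet.mp hm).2
  have h2 : L ((2 : ℕ) : ℤ) = -1 := L_prime Nat.prime_two
  rw [L_prime hp, show ((2 * m + 1 + 1 : ℕ) : ℤ) = ((2 : ℕ) : ℤ) * ((m + 1 : ℕ) : ℤ) by push_cast; ring,
    L_natCast_mul, h2]
  ring

/-! ## Scaling symmetry of the pencil sums -/

/-- `L` is completely multiplicative against a natural factor on all of `ℤ` (both sides vanish on
nonpositive arguments). -/
theorem L_natCast_mul_int (d : ℕ) (x : ℤ) : L ((d : ℤ) * x) = L d * L x := by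
  rcases le_or_gt x 0 with hx | hx
  · rw [L_nonpos_arg (mul_nonpos_of_nonneg_of_nonpos (by positivity) hx), L_nonpos_arg hx,
      mul_zero]
  · lift x to ℕ using hx.le
    exact L_natCast_mul d x

/-- **Scaling symmetry of the pencil sums**: `S (d·c) (d·n) (d·n') M = S c n n' M` for `d ≥ 1`
(`λ(d·u) = λ(d)λ(u)` and `λ(d)² = 1`).  So the instance `(c,n,n')` of the crux reappears verbatim
at `(dc, dn, dn')` whenever `dn' ≤ 2M`: shift `c = 1` controls every instance with `c ∣ n`, `c ∣ n'`,
and nothing is lost or gained by common factors of `(c, n, n')`. -/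
theorem S_scale (c : ℤ) (d n n' M : ℕ) (hd : 1 ≤ d) :
    S ((d : ℤ) * c) (d * n) (d * n') M = S c n n' M := by
  unfold S
  refine sum_congr rfl fun m _ => ?_
  have h1 : (m : ℤ) * ((d * n : ℕ) : ℤ) + (d : ℤ) * c = (d : ℤ) * ((m : ℤ) * n + c) := by
    push_cast; ring
  have h2 : (m : ℤ) * ((d * n' : ℕ) : ℤ) + (d : ℤ) * c = (d : ℤ) * ((m : ℤ) * n' + c) := by
    push_cast; ring
  rw [h1, h2, L_natCast_mul_int, L_natCast_mul_int]
  have hd2 : L d * L d = 1 := L_mul_self_of_pos (by exact_mod_cast hd)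
  linear_combination (L ((m : ℤ) * n + c) * L ((m : ℤ) * n' + c)) * hd2


end Summit.Parity.GeneralizedHardyLittlewood.Theorems.DilatedChowla.Negative

end
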